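import Literature.NumberTheory.NumberFields.CMFieldClassGroupNormConj
import Literature.NumberTheory.NumberFields.ClassGroupNormSurjective
import Literature.NumberTheory.NumberFields.ClassGroupNormCyclotomic
import Literature.NumberTheory.NumberFields.CMFieldImaginaryTraceOverDisjointField
import HarnessLib

/-!
# Inclusion of CM fields and divisibility of relative class numbers: `h⁻_K ∣ 2^{r₁} h⁻_L`
# (Okazaki, *Acta Arith.* 92 (2000), Lemma 24, in the case `L ∩ H_K = K`)

Topic `NumberTheory/NumberFields`; namespace `Literature.NumberTheory.NumberFields`.  Theorem-only file
(no definition, no named fact, no `sorry`), unconditional.  Sequel of `CMFieldClassGroupNormConj.lean`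
(`ker N_{K/K⁺} ⊆ C_K⁻` for a CM field `K`), `ClassGroupNormGalois.lean` (`N(σ • c) = N(c)` for
`σ ∈ Gal(L/K)`), `ClassGroupNormSurjective.lean` (`N_{L/K}(Cl_L) = Cl_K` iff `L ∩ H_K = K`,
Washington Thm. 10.1; `#ker N_{K/K⁺} · h_{K⁺} = h_K`) and `ClassGroupNormCyclotomic.lean` (the norm maps
in cyclotomic towers are onto).

> R. Okazaki, *Inclusion of CM-fields and divisibility of relative class numbers*, Acta Arith. 92
> (2000) 319–338, §1: "The quotient `h⁻_F = h_F/h_{F⁺}` is called the relative class number of `F`.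
> When two CM-fields `k` and `K` satisfy `k ⊂ K`, we say `k ⊂ K` are (two) CM-fields."  §4,
> **Lemma 24.** "Let `k ⊂ K` be two CM-fields, and `r₁` the `2`-rank of `ker(N : C_k → C_{k⁺})`.
> Then `h⁻_k ∣ 2^{r₁} h⁻_K`."  §5, **Corollary 29.** "Let `k ⊂ K` be two CM-fields.  Assume that
> `[K : k]` is odd.  Then `h⁻_k ∣ h⁻_K`."  (Proof of Lemma 24: "`σ` acts as inversion on `C₁/C₀`";
> proof of Prop. 27: the complex conjugation "preserves `Im(N : C_K → C_k)`".)

Okazaki proves Lemma 24 for every pair of CM fields by class field theory (his Lemma 21,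
`[H_k : H_k⁰] ∣ h⁻_K`).  This file proves it by an elementary Galois-descent argument **under the extra
hypothesis that `N_{K/k} : C_K → C_k` is surjective** (equivalently `K ∩ H_k = k`, Washington
Thm. 10.1; e.g. whenever some prime is totally ramified in `K/k`, tree
`classGroupNorm_surjective_of_ramificationIdx_eq_finrank`), which covers the cyclotomic application
`ℚ(√−p) ⊂ ℚ(ζ_p)` of the sequel:

1. (§1) the norm map commutes with automorphisms *semilinearly*: for an automorphism `σ` of `L`
   restricting to `σ_K` on `K`, `N_{L/K}(σ x) = σ_K(N_{L/K} x)` on `𝓞 L` (`intNorm_intAut_eq`), on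
   ideals (`relNorm_map_intAut_eq`) and on classes (`classGroupNorm_mulEquiv_intAut`);
2. (§2) hence for CM fields `K ⊆ L` (written `(K, L)` for Okazaki's `(k, K)`) `N_{L/K}` commutes with
   the complex conjugations, maps `A_L := ker N_{L/L⁺}` into `C_K⁻ = {c : c̄ = c⁻¹}`, and — when `N_{L/K}`
   is onto — every `c ∈ C_K⁻` has `c² = N_{L/K}(c̃ / \overline{c̃}) ∈ N_{L/K}(A_L)`;
3. (§3) so the squaring map `A_K → Cl_K` lands in `N_{L/K}(A_L)`, whence
   `#A_K ∣ #A_K[2] · #A_L`, i.e. `h⁻_K ∣ 2^{r₁} h⁻_L`; for `h⁻_K` odd squaring is bijective on `A_K` and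
   `h⁻_K ∣ h⁻_L` (Cor. 29's conclusion in this case);
4. (§4) for `K` with `h_{K⁺} = 1` — an imaginary quadratic field — `h_K` odd gives `h_K ∣ h⁻_L`.

## Main results (`K L : Type` CM number fields, `L` a `K`-algebra; `K⁺ = maximalRealSubfield K`;
complex conjugation acting on `Cl` through `ClassGroup.mulEquiv (AmbiguousClass.intAut (complexConj ·))`)

* `classGroupNorm_mulEquiv_intAut` — **`N_{L/K}(σ • c) = σ|_K • N_{L/K}(c)`** (any number fields).
* `IsCMField.classGroupNorm_conj_smul` — `N_{L/K}(c̄) = \overline{N_{L/K} c}`;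
  `IsCMField.conj_smul_classGroupNorm_eq_inv` — `N_{L/K}(ker N_{L/L⁺}) ⊆ C_K⁻`;
  `IsCMField.exists_mem_ker_classGroupNorm_eq_sq` — `c̄ = c⁻¹ ⟹ c² ∈ N_{L/K}(ker N_{L/L⁺})` (`N_{L/K}` onto).
* **`IsCMField.card_ker_dvd_card_twoTorsion_mul_card_ker`** — `#ker N_{K/K⁺} ∣ #(ker N_{K/K⁺})[2] · #ker N_{L/L⁺}`
  (Lemma 24 with `N_{L/K}` onto); `IsCMField.classNumber_div_dvd_card_twoTorsion_mul_classNumber_div` —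
  the same as `h_K/h_{K⁺} ∣ 2^{r₁} · h_L/h_{L⁺}`.
* **`IsCMField.classNumber_div_dvd_classNumber_div_of_odd`** — `h⁻_K` odd ⟹ `h⁻_K ∣ h⁻_L` (`N_{L/K}` onto).
* `IsCMField.classNumber_dvd_classNumber_div_of_finrank_eq_two` — `[K : ℚ] = 2`, `h_K` odd,
  `N_{L/K}` onto ⟹ `h_K ∣ h⁻_L`.
* (§5, appended) `classGroupExtend_mulEquiv_intAut`, `IsCMField.classGroupExtend_conj_smul` — the
  extension map `Cl_K → Cl_L` is equivariant too («`σ` obviously preserves `ιC_{k⁺}`»).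
* (§6, appended) **`IsCMField.card_ker_dvd_index_mul_card_twoTorsion_mul_card_ker`** — for EVERY pair of
  CM fields: `h⁻_K ∣ [Cl_K : N_{L/K} Cl_L] · #(ker N_{K/K⁺} ∩ N_{L/K} Cl_L)[2] · h⁻_L`, and
  `IsCMField.exists_classNumber_div_dvd_finrank_mul` — `= [L ∩ H_K : K] · … · h⁻_L` with `L ∩ H_K` the
  largest unramified abelian subextension (tree `exists_index_range_classGroupNorm_eq_finrank`).
* (§7, appended) `classNumber_div_dvd_of_isCyclotomicExtension_of_dvd(_of_odd)` — cyclotomic towers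
  `ℚ(ζ_m) ⊆ ℚ(ζ_n)`, `m ∣ n`: `h⁻_m ∣ 2^{r₁} h⁻_n`, and `h⁻_m ∣ h⁻_n` when `h⁻_m` is odd.

## References

* R. Okazaki, *Inclusion of CM-fields and divisibility of relative class numbers*, Acta Arith. 92 (2000)
  319–338, §1, §4 Lemma 24, §5 Prop. 27, Cor. 29 (held `paper:doi-10-4064-aa-92-4-319-338`, pp. 1,
  11–12, 13–14). [Okazaki2000]
* L. C. Washington, *Introduction to Cyclotomic Fields*, 2nd ed., GTM 83 (1997), Thm. 4.10, Thm. 10.1.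
  [Washington1997]
* S. Lang, *Cyclotomic Fields I and II*, GTM 121 (1990), Ch. 3 §4, Thm. 4.3, Thm. 4.4. [Lang1990]
-/

noncomputable section

open NumberField NumberField.IsCMField IsDedekindDomain
open scoped nonZeroDivisors

namespace Literature.NumberTheory.NumberFields

/-! ### §1. Semilinear Galois equivariance of `N_{L/K}` on integers, ideals and ideal classes -/

section Equivariance

variable (K L : Type) [Field K] [NumberField K] [Field L] [NumberField L] [Algebra K L]
variable {E E' : Type*} [Field E] [Algebra E L] [Field E'] [Algebra E' K]

/-- **`N_{L/K}(σ x) = σ|_K (N_{L/K} x)` on algebraic integers**: if the automorphism `σ` of `L` restricts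
to the automorphism `σ_K` of the subfield `K` (`σ ∘ i = i ∘ σ_K`), then the integral norm
`𝓞 L → 𝓞 K` intertwines the two (Mathlib `Algebra.norm_eq_of_equiv_equiv` along the square
`(σ_K, σ)`, read on `𝓞 L` through `Algebra.algebraMap_intNorm`) — the fact behind «`σ` preserves
`Im(N : C_K → C_k)`» in Okazaki's proof of Prop. 27. [cite: Okazaki2000, §5, proof of Prop. 27] -/
theorem intNorm_intAut_eq (σ : L ≃ₐ[E] L) (σK : K ≃ₐ[E'] K)
    (hσ : ∀ x : K, σ (algebraMap K L x) = algebraMap K L (σK x)) (x : 𝓞 L) :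
    Algebra.intNorm (𝓞 K) (𝓞 L) (AmbiguousClass.intAut σ x) =
      AmbiguousClass.intAut σK (Algebra.intNorm (𝓞 K) (𝓞 L) x) := by
  apply RingOfIntegers.coe_injective
  have he : (algebraMap K L).comp (σK.toRingEquiv : K →+* K) =
      (σ.toRingEquiv : L →+* L).comp (algebraMap K L) := by
    ext y
    simp only [RingHom.coe_comp, RingHom.coe_coe, Function.comp_apply]
    exact (hσ y).symm
  have h1 : ((Algebra.intNorm (𝓞 K) (𝓞 L) (AmbiguousClass.intAut σ x) : 𝓞 K) : K) =
      Algebra.norm K (σ (x : L)) :=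
    Algebra.algebraMap_intNorm (A := 𝓞 K) (K := K) (L := L) (B := 𝓞 L) _
  have h2 : ((Algebra.intNorm (𝓞 K) (𝓞 L) x : 𝓞 K) : K) = Algebra.norm K (x : L) :=
    Algebra.algebraMap_intNorm (A := 𝓞 K) (K := K) (L := L) (B := 𝓞 L) _
  have h3 := Algebra.norm_eq_of_equiv_equiv σK.toRingEquiv σ.toRingEquiv he (x : L)
  change ((Algebra.intNorm (𝓞 K) (𝓞 L) (AmbiguousClass.intAut σ x) : 𝓞 K) : K) =
    ((AmbiguousClass.intAut σK (Algebra.intNorm (𝓞 K) (𝓞 L) x) : 𝓞 K) : K)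
  rw [h1, RingOfIntegers.mapRingEquiv_apply, h2, h3]
  simp

omit [NumberField L] in
/-- `σ(J)`, as a set, is the image of `J` (for a ring automorphism). [folklore] -/
private theorem coe_map_intAut (σ : L ≃ₐ[E] L) (J : Ideal (𝓞 L)) :
    ((J.map (AmbiguousClass.intAut σ : 𝓞 L →+* 𝓞 L) : Ideal (𝓞 L)) : Set (𝓞 L)) =
      (AmbiguousClass.intAut σ) '' (J : Set (𝓞 L)) := by
  ext y
  rw [SetLike.mem_coe, Ideal.mem_map_iff_of_surjective (AmbiguousClass.intAut σ : 𝓞 L →+* 𝓞 L)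
    (fun z => ⟨(AmbiguousClass.intAut σ).symm z, (AmbiguousClass.intAut σ).apply_symm_apply z⟩),
    Set.mem_image]
  simp only [SetLike.mem_coe, RingHom.coe_coe]

/-- **`N_{L/K}(σ𝔞) = σ|_K (N_{L/K} 𝔞)` on ideals**: the relative ideal norm (Mathlib `Ideal.relNorm`)
intertwines a field automorphism `σ` of `L` with its restriction `σ_K` to `K`.  (Mathlib's
`Ideal.relNorm_map_algEquiv` is the case `σ_K = 1`, i.e. `σ ∈ Gal(L/K)`.)
[cite: Okazaki2000, §5, proof of Prop. 27 («σ preserves C_K and hence it preserves Im(N : C_K → C_k)»)] -/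
theorem relNorm_map_intAut_eq (σ : L ≃ₐ[E] L) (σK : K ≃ₐ[E'] K)
    (hσ : ∀ x : K, σ (algebraMap K L x) = algebraMap K L (σK x)) (J : Ideal (𝓞 L)) :
    Ideal.relNorm (𝓞 K) (J.map (AmbiguousClass.intAut σ : 𝓞 L →+* 𝓞 L)) =
      (Ideal.relNorm (𝓞 K) J).map (AmbiguousClass.intAut σK : 𝓞 K →+* 𝓞 K) := by
  rw [Ideal.map_relNorm, ← Ideal.spanNorm_eq, Ideal.spanNorm, Ideal.map, coe_map_intAut,
    Set.image_image]
  refine congrArg Ideal.span (Set.image_congr' fun x => ?_)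
  rw [Function.comp_apply, RingHom.coe_coe]
  exact intNorm_intAut_eq K L σ σK hσ x

/-- **`N_{L/K}(σ • c) = σ|_K • N_{L/K}(c)` on ideal classes** (semilinear Galois equivariance of the
norm map `classGroupNorm`): for an automorphism `σ` of `L` restricting to `σ_K` on `K`, with `σ`,
`σ_K` acting on `Cl_L`, `Cl_K` through `ClassGroup.mulEquiv (AmbiguousClass.intAut ·)`.  The tree's
`classGroupNorm_galois_smul` is the case `σ_K = 1`.
[cite: Okazaki2000, §5, proof of Prop. 27 («σ preserves C_K and hence it preserves Im(N : C_K → C_k)»)] -/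
theorem classGroupNorm_mulEquiv_intAut (σ : L ≃ₐ[E] L) (σK : K ≃ₐ[E'] K)
    (hσ : ∀ x : K, σ (algebraMap K L x) = algebraMap K L (σK x)) (c : ClassGroup (𝓞 L)) :
    classGroupNorm K L (ClassGroup.mulEquiv (AmbiguousClass.intAut σ) c) =
      ClassGroup.mulEquiv (AmbiguousClass.intAut σK) (classGroupNorm K L c) := by
  classical
  obtain ⟨J, rfl⟩ := ClassGroup.mk0_surjective c
  rw [AmbiguousClass.mulEquiv_mk0, classGroupNorm_mk0, classGroupNorm_mk0,
    AmbiguousClass.mulEquiv_mk0]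
  congr 1
  apply Subtype.ext
  exact relNorm_map_intAut_eq K L σ σK hσ J

end Equivariance

/-! ### §2. CM fields `K ⊆ L`: `N_{L/K}` commutes with complex conjugation; `N_{L/K}(ker N_{L/L⁺}) ⊆ C_K⁻`;
every square of `C_K⁻` is a norm from `ker N_{L/L⁺}` when `N_{L/K}` is onto -/

section CM

variable (K L : Type) [Field K] [NumberField K] [IsCMField K] [Field L] [NumberField L]
  [IsCMField L] [Algebra K L]

/-- **`N_{L/K}(c̄) = \overline{N_{L/K}(c)}`** for CM fields `K ⊆ L`: the complex conjugation of `L`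
restricts to that of `K` (`algebraMap_complexConj`), so `classGroupNorm K L` commutes with the two
complex conjugations acting on `Cl_L`, `Cl_K`. [cite: Okazaki2000, §5, proof of Prop. 27 («σ preserves C_K and hence it preserves Im(N : C_K → C_k)»)] -/
theorem IsCMField.classGroupNorm_conj_smul (c : ClassGroup (𝓞 L)) :
    classGroupNorm K L (ClassGroup.mulEquiv (AmbiguousClass.intAut (complexConj L)) c) =
      ClassGroup.mulEquiv (AmbiguousClass.intAut (complexConj K)) (classGroupNorm K L c) :=
  classGroupNorm_mulEquiv_intAut K L (complexConj L) (complexConj K)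
    (fun x => (algebraMap_complexConj x).symm) c

/-- **`N_{L/K}` maps `ker N_{L/L⁺}` into the minus part `C_K⁻`**: if `N_{L/L⁺} a = 1` then the class
`b = N_{L/K} a` of `K` satisfies `b̄ = b⁻¹` (`ā = a⁻¹` by `CMFieldClassGroupNormConj`, and `N_{L/K}`
commutes with conjugation). [cite: Okazaki2000, §4 Lemma 24 (proof: «σ acts as inversion on C₁/C₀»)] -/
theorem IsCMField.conj_smul_classGroupNorm_eq_inv {a : ClassGroup (𝓞 L)}
    (ha : classGroupNorm (maximalRealSubfield L) L a = 1) :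
    ClassGroup.mulEquiv (AmbiguousClass.intAut (complexConj K)) (classGroupNorm K L a) =
      (classGroupNorm K L a)⁻¹ := by
  rw [← IsCMField.classGroupNorm_conj_smul, IsCMField.conj_smul_eq_inv_of_classGroupNorm_eq_one L ha,
    map_inv]

/-- `c̃ / \overline{c̃}` lies in `ker N_{L/L⁺}` (the norm to `L⁺` is constant on conjugate classes).
[cite: Okazaki2000, §5 (4) and Lemma 26 (proof)] -/
theorem IsCMField.mul_conj_smul_inv_mem_ker (d : ClassGroup (𝓞 L)) :
    d * (ClassGroup.mulEquiv (AmbiguousClass.intAut (complexConj L)) d)⁻¹ ∈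
      (classGroupNorm (maximalRealSubfield L) L).ker := by
  rw [MonoidHom.mem_ker, map_mul, map_inv, classGroupNorm_galois_smul, mul_inv_cancel]

/-- **Every square of the minus part is a norm from `ker N_{L/L⁺}` when `N_{L/K}` is onto**: if
`N_{L/K} : Cl_L → Cl_K` is surjective (e.g. `L ∩ H_K = K`, Washington Thm. 10.1) and the class `c` of the
CM field `K` satisfies `c̄ = c⁻¹`, then `c² = N_{L/K}(a)` for some `a ∈ ker N_{L/L⁺}` — namely
`a = c̃ / \overline{c̃}` for any lift `c̃` of `c`: `N_{L/K}(a) = c · \overline{c}⁻¹ = c²`.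
[cite: Okazaki2000, §4 Lemma 24] [cite: Washington1997, Thm. 10.1] -/
theorem IsCMField.exists_mem_ker_classGroupNorm_eq_sq (hN : Function.Surjective (classGroupNorm K L))
    {c : ClassGroup (𝓞 K)} (hc : ClassGroup.mulEquiv (AmbiguousClass.intAut (complexConj K)) c = c⁻¹) :
    ∃ a ∈ (classGroupNorm (maximalRealSubfield L) L).ker, classGroupNorm K L a = c ^ 2 := by
  obtain ⟨d, rfl⟩ := hN c
  refine ⟨d * (ClassGroup.mulEquiv (AmbiguousClass.intAut (complexConj L)) d)⁻¹,
    IsCMField.mul_conj_smul_inv_mem_ker L d, ?_⟩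
  rw [map_mul, map_inv, IsCMField.classGroupNorm_conj_smul, hc, inv_inv, sq]

/-- In particular every square of `ker N_{K/K⁺}` is a norm from `ker N_{L/L⁺}`:
**`(ker N_{K/K⁺})² ≤ N_{L/K}(ker N_{L/L⁺})`** when `N_{L/K}` is onto.
[cite: Okazaki2000, §4 Lemma 24] -/
theorem IsCMField.sq_mem_map_ker_classGroupNorm (hN : Function.Surjective (classGroupNorm K L))
    {c : ClassGroup (𝓞 K)} (hc : c ∈ (classGroupNorm (maximalRealSubfield K) K).ker) :
    c ^ 2 ∈ ((classGroupNorm (maximalRealSubfield L) L).ker).map (classGroupNorm K L) := by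
  obtain ⟨a, ha, hac⟩ := IsCMField.exists_mem_ker_classGroupNorm_eq_sq K L hN
    (IsCMField.conj_smul_eq_inv_of_classGroupNorm_eq_one K hc)
  exact ⟨a, ha, hac⟩

end CM

/-! ### §3. Relative class numbers: `h⁻_K ∣ #(ker N_{K/K⁺})[2] · h⁻_L`, and `h⁻_K ∣ h⁻_L` for `h⁻_K` odd -/

section RelativeClassNumber

variable (K L : Type) [Field K] [NumberField K] [IsCMField K] [Field L] [NumberField L]
  [IsCMField L] [Algebra K L]

/-- **`h⁻ = h_K / h_{K⁺} = #ker(N_{K/K⁺} : Cl_K → Cl_{K⁺})`** for a CM field `K` (Okazaki: «It is known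
that `h_{F⁺}` divides `h_F`.  The quotient `h⁻_F = h_F/h_{F⁺}` is called the relative class number»; the
norm map to `K⁺` is onto, tree `IsCMField.card_ker_classGroupNorm_mul_card`).
[cite: Okazaki2000, §1 (definition of h⁻_F)] [cite: Washington1997, Thm. 4.10 and Thm. 10.1] -/
theorem IsCMField.classNumber_div_eq_card_ker :
    classNumber K / classNumber (maximalRealSubfield K) =
      Nat.card (classGroupNorm (maximalRealSubfield K) K).ker := by
  unfold classNumber
  rw [← IsCMField.card_ker_classGroupNorm_mul_card K]
  exact Nat.mul_div_cancel _ Fintype.card_pos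

/-- **Okazaki's Lemma 24 in the case `L ∩ H_K = K`**: for CM fields `K ⊆ L` such that
`N_{L/K} : Cl_L → Cl_K` is surjective, `#ker N_{K/K⁺}` divides `#(ker N_{K/K⁺})[2] · #ker N_{L/L⁺}`, i.e.
**`h⁻_K ∣ 2^{r₁} h⁻_L`** with `2^{r₁} = #{c ∈ ker N_{K/K⁺} : c² = 1}` (`r₁` = the `2`-rank of
`ker(N : C_K → C_{K⁺})`).  Okazaki proves this for ALL pairs of CM fields `k ⊂ K` by class field theory;
here, under the surjectivity hypothesis, it follows from §2: the squaring map on `ker N_{K/K⁺}` has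
image inside `N_{L/K}(ker N_{L/L⁺})`, a group of order dividing `#ker N_{L/L⁺}`.
-- TODO(general form): drop the hypothesis `hN` (Okazaki's Lemma 21: `[H_k : H_k⁰] ∣ h⁻_K`).
[cite: Okazaki2000, §4 Lemma 24] [cite: Washington1997, Thm. 10.1] -/
theorem IsCMField.card_ker_dvd_card_twoTorsion_mul_card_ker
    (hN : Function.Surjective (classGroupNorm K L)) :
    Nat.card (classGroupNorm (maximalRealSubfield K) K).ker ∣
      Nat.card {c : (classGroupNorm (maximalRealSubfield K) K).ker // (c : ClassGroup (𝓞 K)) ^ 2 = 1} *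
        Nat.card (classGroupNorm (maximalRealSubfield L) L).ker := by
  classical
  set AK := (classGroupNorm (maximalRealSubfield K) K).ker with hAK
  set AL := (classGroupNorm (maximalRealSubfield L) L).ker with hAL
  -- the squaring map `AK → Cl_K`
  set f : AK →* ClassGroup (𝓞 K) := (powMonoidHom 2).comp AK.subtype with hf
  have hrange : f.range ≤ AL.map (classGroupNorm K L) := by
    rintro _ ⟨c, rfl⟩
    exact IsCMField.sq_mem_map_ker_classGroupNorm K L hN c.2
  have hker : Nat.card f.ker = Nat.card {c : AK // (c : ClassGroup (𝓞 K)) ^ 2 = 1} :=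
    Nat.card_congr (Equiv.subtypeEquivRight fun c => by
      rw [MonoidHom.mem_ker, hf, MonoidHom.comp_apply, powMonoidHom_apply, Subgroup.subtype_apply])
  have hcard : Nat.card f.ker * Nat.card f.range = Nat.card AK := by
    rw [← Subgroup.index_ker, Subgroup.card_mul_index]
  rw [← hcard, ← hker]
  exact Nat.mul_dvd_mul_left _
    ((Subgroup.card_dvd_of_le hrange).trans (Subgroup.card_map_dvd _ _))

/-- **`h⁻_K` odd ⟹ `h⁻_K ∣ h⁻_L`** for CM fields `K ⊆ L` with `N_{L/K} : Cl_L → Cl_K` surjective: then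
squaring is a bijection of `ker N_{K/K⁺}`, so `ker N_{K/K⁺} ≤ N_{L/K}(ker N_{L/L⁺})` (Okazaki's Lemma 24
with `r₁ = 0`; cf. Cor. 29: `[K : k]` odd ⟹ `h⁻_k ∣ h⁻_K`).
[cite: Okazaki2000, §4 Lemma 24 and §5 Cor. 29] [cite: Washington1997, Thm. 10.1] -/
theorem IsCMField.card_ker_dvd_card_ker_of_odd (hN : Function.Surjective (classGroupNorm K L))
    (hodd : Odd (Nat.card (classGroupNorm (maximalRealSubfield K) K).ker)) :
    Nat.card (classGroupNorm (maximalRealSubfield K) K).ker ∣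
      Nat.card (classGroupNorm (maximalRealSubfield L) L).ker := by
  set AK := (classGroupNorm (maximalRealSubfield K) K).ker with hAK
  set AL := (classGroupNorm (maximalRealSubfield L) L).ker with hAL
  have hcop : (Nat.card AK).Coprime 2 := Nat.coprime_two_right.mpr hodd
  have hle : AK ≤ AL.map (classGroupNorm K L) := by
    intro c hc
    -- `c = d²` for `d = c^{1/2} ∈ AK`
    set d : AK := (powCoprime hcop).symm ⟨c, hc⟩ with hd
    have hdc : ((d ^ 2 : AK) : ClassGroup (𝓞 K)) = c := by
      rw [← powCoprime_apply hcop d, hd, Equiv.apply_symm_apply]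
    rw [← hdc, Subgroup.coe_pow]
    exact IsCMField.sq_mem_map_ker_classGroupNorm K L hN d.2
  exact (Subgroup.card_dvd_of_le hle).trans (Subgroup.card_map_dvd _ _)

/-- The same in terms of class numbers: **for CM fields `K ⊆ L` with `N_{L/K}` onto the class group of
`K` and `h⁻_K = h_K/h_{K⁺}` odd, `h⁻_K ∣ h⁻_L = h_L/h_{L⁺}`.**
[cite: Okazaki2000, §4 Lemma 24 and §5 Cor. 29] [cite: Washington1997, Thm. 10.1] -/
theorem IsCMField.classNumber_div_dvd_classNumber_div_of_odd
    (hN : Function.Surjective (classGroupNorm K L))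
    (hodd : Odd (classNumber K / classNumber (maximalRealSubfield K))) :
    classNumber K / classNumber (maximalRealSubfield K) ∣
      classNumber L / classNumber (maximalRealSubfield L) := by
  rw [IsCMField.classNumber_div_eq_card_ker] at hodd ⊢
  rw [IsCMField.classNumber_div_eq_card_ker]
  exact IsCMField.card_ker_dvd_card_ker_of_odd K L hN hodd

/-- **`h⁻_K ∣ 2^{r₁} · h⁻_L` in terms of class numbers** (`2^{r₁} = #(ker N_{K/K⁺})[2]`), for CM fields
`K ⊆ L` with `N_{L/K}` onto. [cite: Okazaki2000, §4 Lemma 24] [cite: Washington1997, Thm. 10.1] -/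
theorem IsCMField.classNumber_div_dvd_card_twoTorsion_mul_classNumber_div
    (hN : Function.Surjective (classGroupNorm K L)) :
    classNumber K / classNumber (maximalRealSubfield K) ∣
      Nat.card {c : (classGroupNorm (maximalRealSubfield K) K).ker // (c : ClassGroup (𝓞 K)) ^ 2 = 1} *
        (classNumber L / classNumber (maximalRealSubfield L)) := by
  rw [IsCMField.classNumber_div_eq_card_ker, IsCMField.classNumber_div_eq_card_ker]
  exact IsCMField.card_ker_dvd_card_twoTorsion_mul_card_ker K L hN

end RelativeClassNumber

/-! ### §4. `K` with `h_{K⁺} = 1` (e.g. an imaginary quadratic field): `h_K` odd ⟹ `h_K ∣ h⁻_L` -/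

section RealSubfieldClassNumberOne

variable (K L : Type) [Field K] [NumberField K] [IsCMField K] [Field L] [NumberField L]
  [IsCMField L] [Algebra K L]

omit [IsCMField K] in
/-- If `h_{K⁺} = 1` then `h⁻_K = h_K / h_{K⁺} = h_K`. [cite: Okazaki2000, §1 (definition of h⁻_F) and Cor. 2 (k imaginary quadratic)] -/
theorem IsCMField.classNumber_div_eq_classNumber (h1 : classNumber (maximalRealSubfield K) = 1) :
    classNumber K / classNumber (maximalRealSubfield K) = classNumber K := by
  rw [h1, Nat.div_one]

omit [IsCMField K] in
/-- If `h_{K⁺} = 1` then `ker N_{K/K⁺}` is all of `Cl_K`. [cite: Okazaki2000, §1 (definition of h⁻_F)] -/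
theorem IsCMField.ker_classGroupNorm_eq_top (h1 : classNumber (maximalRealSubfield K) = 1) :
    (classGroupNorm (maximalRealSubfield K) K).ker = ⊤ := by
  haveI : Subsingleton (ClassGroup (𝓞 (maximalRealSubfield K))) :=
    Fintype.card_le_one_iff_subsingleton.mp (le_of_eq h1)
  exact eq_top_iff.mpr fun c _ => Subsingleton.elim _ _

/-- **`h_K` odd and `h_{K⁺} = 1` ⟹ `h_K ∣ h⁻_L`** for a CM field `L ⊇ K` with `N_{L/K} : Cl_L → Cl_K`
surjective — the shape used for an imaginary quadratic field `K = k` inside a CM field (Okazaki's Cor. 2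
setting, `h⁻_k = h_k`). [cite: Okazaki2000, §4 Lemma 24, §5 Cor. 29 and §1 Cor. 2] [cite: Washington1997, Thm. 10.1] -/
theorem IsCMField.classNumber_dvd_classNumber_div_of_odd (hN : Function.Surjective (classGroupNorm K L))
    (h1 : classNumber (maximalRealSubfield K) = 1) (hodd : Odd (classNumber K)) :
    classNumber K ∣ classNumber L / classNumber (maximalRealSubfield L) := by
  have h := IsCMField.classNumber_div_dvd_classNumber_div_of_odd K L hN
  rw [IsCMField.classNumber_div_eq_classNumber K h1] at h
  exact h hodd

/-- A CM field of absolute degree `2` (an imaginary quadratic field) has `h_{K⁺} = 1`: `K⁺ = ℚ`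
(`[K : K⁺] = 2`) and `h(ℚ) = 1`. [folklore] -/
private theorem classNumber_maximalRealSubfield_eq_one_of_finrank_eq_two (hK : Module.finrank ℚ K = 2) :
    classNumber (maximalRealSubfield K) = 1 := by
  have h1 : Module.finrank ℚ (maximalRealSubfield K) = 1 := by
    have h := Module.finrank_mul_finrank ℚ (maximalRealSubfield K) K
    rw [Algebra.IsQuadraticExtension.finrank_eq_two (maximalRealSubfield K) K, hK] at h
    omega
  have e : maximalRealSubfield K ≃ₐ[ℚ] ℚ :=
    (Subalgebra.topEquiv.symm.trans (Subalgebra.equivOfEq _ _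
      (Subalgebra.bot_eq_top_iff_finrank_eq_one.mpr h1).symm)).trans
      (Algebra.botEquiv ℚ (maximalRealSubfield K))
  unfold classNumber
  rw [Fintype.card_congr (ClassGroup.mulEquiv (RingOfIntegers.mapRingEquiv e.toRingEquiv)).toEquiv]
  exact Rat.classNumber_eq

/-- **Imaginary quadratic `K` inside a CM field `L` with `N_{L/K}` onto and `h_K` odd: `h_K ∣ h⁻_L`.**
[cite: Okazaki2000, §4 Lemma 24, §5 Cor. 29 and §1 Cor. 2] [cite: Washington1997, Thm. 10.1] -/
theorem IsCMField.classNumber_dvd_classNumber_div_of_finrank_eq_two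
    (hN : Function.Surjective (classGroupNorm K L)) (hK : Module.finrank ℚ K = 2)
    (hodd : Odd (classNumber K)) :
    classNumber K ∣ classNumber L / classNumber (maximalRealSubfield L) :=
  IsCMField.classNumber_dvd_classNumber_div_of_odd K L hN
    (classNumber_maximalRealSubfield_eq_one_of_finrank_eq_two K hK) hodd

/-- The same with `h⁻_L` as the order of `ker N_{L/L⁺}`. [cite: Okazaki2000, §4 Lemma 24 and §5 Cor. 29] -/
theorem IsCMField.classNumber_dvd_card_ker_of_finrank_eq_two
    (hN : Function.Surjective (classGroupNorm K L)) (hK : Module.finrank ℚ K = 2)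
    (hodd : Odd (classNumber K)) :
    classNumber K ∣ Nat.card (classGroupNorm (maximalRealSubfield L) L).ker := by
  rw [← IsCMField.classNumber_div_eq_card_ker]
  exact IsCMField.classNumber_dvd_classNumber_div_of_finrank_eq_two K L hN hK hodd

end RealSubfieldClassNumberOne

/-! ### §5 (appended). The extension map is equivariant too: `i_{L/K}(σ|_K • c) = σ • i_{L/K}(c)` -/

section ExtendEquivariance

variable (K L : Type) [Field K] [NumberField K] [Field L] [NumberField L] [Algebra K L]
variable {E E' : Type*} [Field E] [Algebra E L] [Field E'] [Algebra E' K]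

omit [NumberField K] [NumberField L] in
/-- On integers, `σ ∘ i = i ∘ σ_K` (`i : 𝓞 K → 𝓞 L`), for an automorphism `σ` of `L` restricting to `σ_K`
on `K`. [folklore] -/
private theorem intAut_comp_algebraMap (σ : L ≃ₐ[E] L) (σK : K ≃ₐ[E'] K)
    (hσ : ∀ x : K, σ (algebraMap K L x) = algebraMap K L (σK x)) :
    (AmbiguousClass.intAut σ : 𝓞 L →+* 𝓞 L).comp (algebraMap (𝓞 K) (𝓞 L)) =
      (algebraMap (𝓞 K) (𝓞 L)).comp (AmbiguousClass.intAut σK : 𝓞 K →+* 𝓞 K) := by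
  ext x
  change ((AmbiguousClass.intAut σ (algebraMap (𝓞 K) (𝓞 L) x) : 𝓞 L) : L) =
    ((algebraMap (𝓞 K) (𝓞 L) (AmbiguousClass.intAut σK x) : 𝓞 L) : L)
  have h1 : ((algebraMap (𝓞 K) (𝓞 L) x : 𝓞 L) : L) = algebraMap K L (x : K) := rfl
  have h2 : ((algebraMap (𝓞 K) (𝓞 L) (AmbiguousClass.intAut σK x) : 𝓞 L) : L) =
      algebraMap K L ((AmbiguousClass.intAut σK x : 𝓞 K) : K) := rfl
  rw [RingOfIntegers.mapRingEquiv_apply, h1, h2, RingOfIntegers.mapRingEquiv_apply]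
  exact hσ x

/-- **`i_{L/K}(σ|_K • c) = σ • i_{L/K}(c)`**: the extension map `Cl_K → Cl_L` intertwines an automorphism
`σ` of `L` with its restriction `σ_K` to `K` (`σ(𝔞𝓞_L) = (σ_K 𝔞)𝓞_L`); companion of
`classGroupNorm_mulEquiv_intAut`. [cite: Okazaki2000, §5, proof of Prop. 27 («It obviously preserves ιC_{k⁺}»)] -/
theorem classGroupExtend_mulEquiv_intAut (σ : L ≃ₐ[E] L) (σK : K ≃ₐ[E'] K)
    (hσ : ∀ x : K, σ (algebraMap K L x) = algebraMap K L (σK x)) (c : ClassGroup (𝓞 K)) :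
    classGroupExtend K L (ClassGroup.mulEquiv (AmbiguousClass.intAut σK) c) =
      ClassGroup.mulEquiv (AmbiguousClass.intAut σ) (classGroupExtend K L c) := by
  classical
  obtain ⟨J, rfl⟩ := ClassGroup.mk0_surjective c
  rw [AmbiguousClass.mulEquiv_mk0, classGroupExtend_mk0, classGroupExtend_mk0,
    AmbiguousClass.mulEquiv_mk0]
  congr 1
  apply Subtype.ext
  change ((J : Ideal (𝓞 K)).map (AmbiguousClass.intAut σK : 𝓞 K →+* 𝓞 K)).map
      (algebraMap (𝓞 K) (𝓞 L)) =
    ((J : Ideal (𝓞 K)).map (algebraMap (𝓞 K) (𝓞 L))).map (AmbiguousClass.intAut σ : 𝓞 L →+* 𝓞 L)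
  rw [Ideal.map_map, Ideal.map_map, intAut_comp_algebraMap K L σ σK hσ]

/-- For CM fields `K ⊆ L`: **`i_{L/K}(c̄) = \overline{i_{L/K}(c)}`** («`σ` obviously preserves `ιC`»).
[cite: Okazaki2000, §5, proof of Prop. 27] -/
theorem IsCMField.classGroupExtend_conj_smul [IsCMField K] [IsCMField L] (c : ClassGroup (𝓞 K)) :
    classGroupExtend K L (ClassGroup.mulEquiv (AmbiguousClass.intAut (complexConj K)) c) =
      ClassGroup.mulEquiv (AmbiguousClass.intAut (complexConj L)) (classGroupExtend K L c) :=
  classGroupExtend_mulEquiv_intAut K L (complexConj L) (complexConj K)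
    (fun x => (algebraMap_complexConj x).symm) c

end ExtendEquivariance

/-! ### §6 (appended). Without surjectivity: `h⁻_K ∣ [Cl_K : N_{L/K} Cl_L] · 2^{r₁} · h⁻_L = [L ∩ H_K : K] · 2^{r₁} · h⁻_L` -/

section Index

variable (K L : Type) [Field K] [NumberField K] [IsCMField K] [Field L] [NumberField L]
  [IsCMField L] [Algebra K L]

/-- The squares of `ker N_{K/K⁺} ∩ N_{L/K}(Cl_L)` are norms from `ker N_{L/L⁺}` — for ANY pair of CM fields
`K ⊆ L` (no surjectivity needed: a class that IS a norm, `c = N_{L/K} c̃` with `c̄ = c⁻¹`, has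
`c² = N_{L/K}(c̃/\overline{c̃})`). [cite: Okazaki2000, §4 Lemma 24] -/
theorem IsCMField.sq_mem_map_ker_classGroupNorm_of_mem_range {c : ClassGroup (𝓞 K)}
    (hc : c ∈ (classGroupNorm (maximalRealSubfield K) K).ker) (hcN : c ∈ (classGroupNorm K L).range) :
    c ^ 2 ∈ ((classGroupNorm (maximalRealSubfield L) L).ker).map (classGroupNorm K L) := by
  obtain ⟨d, rfl⟩ := hcN
  refine ⟨d * (ClassGroup.mulEquiv (AmbiguousClass.intAut (complexConj L)) d)⁻¹,
    IsCMField.mul_conj_smul_inv_mem_ker L d, ?_⟩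
  rw [map_mul, map_inv, IsCMField.classGroupNorm_conj_smul,
    IsCMField.conj_smul_eq_inv_of_classGroupNorm_eq_one K hc, inv_inv, sq]

/-- **`#(A_K ∩ N_{L/K} Cl_L) ∣ #(A_K ∩ N_{L/K} Cl_L)[2] · #A_L`** (`A = ker N_{·/·⁺}`) for every pair of CM
fields `K ⊆ L`. [cite: Okazaki2000, §4 Lemma 24] -/
theorem IsCMField.card_ker_inf_range_dvd :
    Nat.card ↥((classGroupNorm (maximalRealSubfield K) K).ker ⊓ (classGroupNorm K L).range) ∣
      Nat.card {c : ↥((classGroupNorm (maximalRealSubfield K) K).ker ⊓ (classGroupNorm K L).range) //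
          (c : ClassGroup (𝓞 K)) ^ 2 = 1} *
        Nat.card (classGroupNorm (maximalRealSubfield L) L).ker := by
  classical
  set B := (classGroupNorm (maximalRealSubfield K) K).ker ⊓ (classGroupNorm K L).range with hB
  set AL := (classGroupNorm (maximalRealSubfield L) L).ker with hAL
  set f : B →* ClassGroup (𝓞 K) := (powMonoidHom 2).comp B.subtype with hf
  have hrange : f.range ≤ AL.map (classGroupNorm K L) := by
    rintro _ ⟨c, rfl⟩
    exact IsCMField.sq_mem_map_ker_classGroupNorm_of_mem_range K L
      (Subgroup.mem_inf.mp c.2).1 (Subgroup.mem_inf.mp c.2).2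
  have hker : Nat.card f.ker = Nat.card {c : B // (c : ClassGroup (𝓞 K)) ^ 2 = 1} :=
    Nat.card_congr (Equiv.subtypeEquivRight fun c => by
      rw [MonoidHom.mem_ker, hf, MonoidHom.comp_apply, powMonoidHom_apply, Subgroup.subtype_apply])
  have hcard : Nat.card f.ker * Nat.card f.range = Nat.card B := by
    rw [← Subgroup.index_ker, Subgroup.card_mul_index]
  rw [← hcard, ← hker]
  exact Nat.mul_dvd_mul_left _
    ((Subgroup.card_dvd_of_le hrange).trans (Subgroup.card_map_dvd _ _))

/-- **Lemma 24 without the surjectivity hypothesis, at the cost of the index of the norm group**: for every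
pair of CM fields `K ⊆ L`,
`#ker N_{K/K⁺} ∣ [Cl_K : N_{L/K}(Cl_L)] · #(ker N_{K/K⁺} ∩ N_{L/K}(Cl_L))[2] · #ker N_{L/L⁺}`,
i.e. `h⁻_K ∣ [L ∩ H_K : K] · 2^{r₁'} · h⁻_L` with `r₁' ≤ r₁` (by the tree's `index_range_classGroupNorm`,
`[Cl_K : N_{L/K}(Cl_L)] = [L ∩ H_K : K]`).  Okazaki's Lemma 24 removes the index factor by class field
theory (his Lemma 21); `-- TODO(general form)`. [cite: Okazaki2000, §4 Lemma 24 and Lemma 21] -/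
theorem IsCMField.card_ker_dvd_index_mul_card_twoTorsion_mul_card_ker :
    Nat.card (classGroupNorm (maximalRealSubfield K) K).ker ∣
      (classGroupNorm K L).range.index *
        (Nat.card {c : ↥((classGroupNorm (maximalRealSubfield K) K).ker ⊓ (classGroupNorm K L).range) //
            (c : ClassGroup (𝓞 K)) ^ 2 = 1} *
          Nat.card (classGroupNorm (maximalRealSubfield L) L).ker) := by
  set AK := (classGroupNorm (maximalRealSubfield K) K).ker with hAK
  set I := (classGroupNorm K L).range with hI
  -- `#A_K = #(A_K ∩ I) · [A_K : A_K ∩ I]` and `[A_K : A_K ∩ I] ∣ [Cl_K : I]`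
  have h1 : Nat.card ↥(I.subgroupOf AK) * (I.subgroupOf AK).index = Nat.card AK :=
    Subgroup.card_mul_index _
  have h2 : (I.subgroupOf AK).index ∣ I.index := Subgroup.relIndex_dvd_index_of_normal I AK
  have h3 : Nat.card ↥(I.subgroupOf AK) = Nat.card ↥(AK ⊓ I) := by
    rw [← Subgroup.inf_subgroupOf_left, Nat.card_congr
      (Subgroup.subgroupOfEquivOfLe (inf_le_left : AK ⊓ I ≤ AK)).toEquiv]
  rw [← h1, h3, mul_comm (Nat.card ↥(AK ⊓ I))]
  exact mul_dvd_mul h2 (IsCMField.card_ker_inf_range_dvd K L)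

/-- The same with the unramified abelian subextension made explicit: there is an intermediate field `F` of
`L/K` (namely `L ∩ H_K`), abelian over `K` and unramified at all finite and infinite places, with
**`h⁻_K ∣ [F : K] · #(ker N_{K/K⁺} ∩ N_{L/K} Cl_L)[2] · h⁻_L`**.
[cite: Okazaki2000, §4 Lemma 24 and Lemma 21] [cite: Washington1997, Thm. 10.1] -/
theorem IsCMField.exists_classNumber_div_dvd_finrank_mul :
    ∃ F : IntermediateField K L, IsAbelianGalois K F ∧ IsUnramifiedAtInfinitePlaces K F ∧
      (∀ v : HeightOneSpectrum (𝓞 K), Algebra.IsUnramifiedIn (𝓞 F) v.asIdeal) ∧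
      classNumber K / classNumber (maximalRealSubfield K) ∣
        Module.finrank K F *
          (Nat.card {c : ↥((classGroupNorm (maximalRealSubfield K) K).ker ⊓ (classGroupNorm K L).range) //
              (c : ClassGroup (𝓞 K)) ^ 2 = 1} *
            (classNumber L / classNumber (maximalRealSubfield L))) := by
  obtain ⟨F, hab, hinf, hunr, -, hidx⟩ := exists_index_range_classGroupNorm_eq_finrank K L
  refine ⟨F, hab, hinf, hunr, ?_⟩
  rw [IsCMField.classNumber_div_eq_card_ker, IsCMField.classNumber_div_eq_card_ker, ← hidx]
  exact IsCMField.card_ker_dvd_index_mul_card_twoTorsion_mul_card_ker K L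

end Index

/-! ### §7 (appended). Cyclotomic towers: `m ∣ n`, `h⁻(ℚ(ζ_m))` odd ⟹ `h⁻(ℚ(ζ_m)) ∣ h⁻(ℚ(ζ_n))` -/

section Cyclotomic

/-- **`h⁻(ℚ(ζ_m)) ∣ 2^{r₁} · h⁻(ℚ(ζ_n))` for `m ∣ n`, `m > 2`** (`2^{r₁} = #(ker N_{K/K⁺})[2]`, `K = ℚ(ζ_m)`,
`L = ℚ(ζ_n)` with any compatible `K`-algebra structure): the norm map `Cl(ℚ(ζ_n)) → Cl(ℚ(ζ_m))` is onto
(tree `classGroupNorm_surjective_of_isCyclotomicExtension_of_dvd`), so §3 applies.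
[cite: Okazaki2000, §4 Lemma 24] [cite: Washington1997, Thm. 10.1 and Prop. 4.11] -/
theorem classNumber_div_dvd_of_isCyclotomicExtension_of_dvd {m n : ℕ} [NeZero n] (hm : 2 < m)
    (hmn : m ∣ n) (K L : Type) [Field K] [NumberField K] [Field L] [NumberField L] [Algebra K L]
    [IsCyclotomicExtension {m} ℚ K] [IsCyclotomicExtension {n} ℚ L] :
    classNumber K / classNumber (maximalRealSubfield K) ∣
      Nat.card {c : (classGroupNorm (maximalRealSubfield K) K).ker // (c : ClassGroup (𝓞 K)) ^ 2 = 1} *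
        (classNumber L / classNumber (maximalRealSubfield L)) := by
  have hn : 2 < n := lt_of_lt_of_le hm (Nat.le_of_dvd (Nat.pos_of_ne_zero (NeZero.ne n)) hmn)
  haveI : IsCMField K := IsCyclotomicExtension.Rat.isCMField K (S := ({m} : Set ℕ)) ⟨m, rfl, hm⟩
  haveI : IsCMField L := IsCyclotomicExtension.Rat.isCMField L (S := ({n} : Set ℕ)) ⟨n, rfl, hn⟩
  exact IsCMField.classNumber_div_dvd_card_twoTorsion_mul_classNumber_div K L
    (classGroupNorm_surjective_of_isCyclotomicExtension_of_dvd hmn K L)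

/-- **`m ∣ n`, `h⁻(ℚ(ζ_m))` odd ⟹ `h⁻(ℚ(ζ_m)) ∣ h⁻(ℚ(ζ_n))`** (`m > 2`; the case `r₁ = 0` of the
previous theorem; the unconditional `h⁻_m ∣ h⁻_n` of Masley–Montgomery / Horie is not reproduced here).
[cite: Okazaki2000, §4 Lemma 24 and §5 Cor. 29] [cite: Washington1997, Thm. 10.1 and Prop. 4.11] -/
theorem classNumber_div_dvd_of_isCyclotomicExtension_of_dvd_of_odd {m n : ℕ} [NeZero n] (hm : 2 < m)
    (hmn : m ∣ n) (K L : Type) [Field K] [NumberField K] [Field L] [NumberField L] [Algebra K L]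
    [IsCyclotomicExtension {m} ℚ K] [IsCyclotomicExtension {n} ℚ L]
    (hodd : Odd (classNumber K / classNumber (maximalRealSubfield K))) :
    classNumber K / classNumber (maximalRealSubfield K) ∣
      classNumber L / classNumber (maximalRealSubfield L) := by
  have hn : 2 < n := lt_of_lt_of_le hm (Nat.le_of_dvd (Nat.pos_of_ne_zero (NeZero.ne n)) hmn)
  haveI : IsCMField K := IsCyclotomicExtension.Rat.isCMField K (S := ({m} : Set ℕ)) ⟨m, rfl, hm⟩
  haveI : IsCMField L := IsCyclotomicExtension.Rat.isCMField L (S := ({n} : Set ℕ)) ⟨n, rfl, hn⟩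
  exact IsCMField.classNumber_div_dvd_classNumber_div_of_odd K L
    (classGroupNorm_surjective_of_isCyclotomicExtension_of_dvd hmn K L) hodd

end Cyclotomic

end Literature.NumberTheory.NumberFields

end
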